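import Summits.QuantumFields.BalabanUV.T4Continuum.Support.ShellMeasureAverageAnalyticB7

/-!
# `T4Continuum.ShellMeasureAverageIterate` — [B7] PROP. 6 (164) SHAPE FOR THE (0.12)∕(15) AVERAGE, file 1∕3: the `k`-FOLD
# ITERATE of the printed one-step block average IN THE CHART is ANALYTIC on an explicit ball, VANISHES at `0`, is LINEARLY
# BOUNDED (file 2 `ShellMeasureAverageIteratePower`: the `k`-fold average of the perturbed configuration RELATIVE to that of
# the background is `exp(i·Q_k)`, hence close to `1`) (cell `pub-balaban`, sub-cell `t4`, spine estimate NE7c (node U5b); NE7c ROUND-2 crew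
# `t4-ne7c-formalise-*`, unit `b2b-balaban-t4-ne7c-formalise-leaf-06` gen 3, owner table `LEAVES-NE7c-P1.md` row S57
# (WALL §3 W-a∕W-d side, LOWER priority than S55∕S56); ADDITIVE — imports the owner's S49 f2 `ShellMeasureAverageAnalyticB7`
# (p219014; hence f1 `ShellMeasureAverageAnalytic` p218694 and `B12AverageCorridor267`) ONLY; 0 sorry, 0 cite tags)

HONEST FRAMING.  Finite four-torus programme, rung (B)+1 only — NOT infinite volume, NOT a mass gap, NOT the Clay
problem, NOT summit progress; (B), `BetaPertHyp`, (B^μ) are not consumed.  NE7c (`T4IndicatorShell.ShellWeightBound`) is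
NOT PRINTED and NOT PROVED; «NE7c ⇐ the named binders».  ELEMENTARY COMPLEX ANALYSIS + BOOKKEEPING ([folklore]); nothing
printed is asserted or cited: [Balaban1985Averaging] Prop. 6 p. 43 («If U₀ satisfies (52), then \overline{U′U₀}ᵏ is an
analytic function of A′ = (1∕(iη)) log U′ … |A′| < α₁ … |\overline{U′U₀}ᵏ(Ū₀ᵏ)⁻¹ − 1| < O(1)α₁ (164)») is the SHAPE
reproduced here for the tree's average `B12AverageCorridor267.avgM` with the printed contours `gammaT` ([B7] (15) =
[Balaban1987RG1] (2.4)), by COMPOSITION of the owner's one-step facts (row S49) — with TWO honest differences DISPLAYED in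
the statements: (i) the radius of analyticity SHRINKS geometrically in `k` (`(2816(d+1)L)^{−(k+1)}`: the one-step bound
used is the crude `‖Q̃(B)‖ ≤ 2816(d+1)L‖B‖`, not print's `(1 + O(L²α₀))‖B‖` of Prop. 3 (124)–(126) — rows S55∕S56), so
the printed `k`-UNIFORM `α₁`-domain in `η`-units (`c₄(d,L)`) is NOT reproduced; (ii) the REGULARITY OF THE AVERAGED
BACKGROUNDS at every level (unit bounds of the bond variables, `ε`-regular off-axis block loops, `ε ≤ 1∕8`) is a
DISPLAYED hypothesis (print: Props 1–2 (52) ⇒ regular at all levels `j ≤ k`; v1.1 CORRECTION (DOCFIX-1 of XREAD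
C-ne7cleaf09-33 = FINDING F-ne7cL04g4-1): the tree's `B7Prop1Explicit.bavg` IS [B7] (42) = (15) and `B7Prop2Explicit`
proves Prop. 2 (52)–(54) for its `k`-fold iterate (43) — v1's clause «stated for the double-bar average (89)–(91), not for
(15)» was WRONG ((89) is `B7Prop3Flat.dbavg`); the transport to the b12 typing is leaf-04-g4's
`ShellMeasureAverageIterateRegular` (row S59) and the discharge of (ii) from (52) — for the levels `j < k` actually used,
see OBJECTION-1 of C-ne7cleaf09-35 — is file 3 `ShellMeasureAverageIterateEnd` (p220136)).  HONEST DEPENDENCY (cell):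
continuum YM on T⁴ ⇐ BetaPertH ∧ nine spine estimates (0/9 proved); BetaPertH ⇐ (D1) ∧ (D4) ∧ CAP+tail; G-an2-4 gates
asym, D1 and NE2/3/4.

## What is proved (all [folklore])

* §1 GENERIC: `iterMap F k` — the composite `F_{k−1} ∘ ⋯ ∘ F₀` of a level-indexed chain of maps `F j : E j → E (j+1)`
  between complex normed spaces; **`iterMap_facts`**: if every `F j` is analytic on `ball 0 r`, `F j 0 = 0`,
  `‖F j B‖ ≤ M‖B‖` there (`M ≥ 1`), then `iterMap F k` is analytic on `ball 0 (r ∕ Mᵏ)`, vanishes at `0`, and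
  `‖iterMap F k B‖ ≤ Mᵏ‖B‖` there.
* §2 THE PYRAMID: extension by zero `ext S B` from a finite bond set `S`, the restriction CLM `restr`, and block locality of
  the chart average (`Qtilde_ext_eq_of_subset`: `Q̃_V(ext_S B)(c) = Q̃_V(ext_{B(c₋)∪B(c₊)}(B|…))(c)` when
  `qppBonds L c ⊆ S`); the one-step chart map `chartStep L T V j : (↥(T j) → 𝔸) → (↥(T (j+1)) → 𝔸)` on a level-indexed
  family of finite bond sets `T j` closed under the block dependency (`hT : ∀ c ∈ T (j+1), qppBonds L c ⊆ T j`) over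
  backgrounds `V j`; its three facts from S49 f2 (`chartStep_analyticOnNhd`, `chartStep_zero`, `norm_chartStep_le`).
* §3 **`chartIter_analyticOnNhd`**, **`chartIter_zero`**, **`norm_chartIter_le`**: the `k`-fold chart iterate
  `chartIter L T V k = chartStep (k−1) ∘ ⋯ ∘ chartStep 0` is analytic on `ball 0 (M^{−(k+1)})`, `M = 2816(d+1)L`, vanishes
  at `0`, `‖chartIter k B‖ ≤ Mᵏ‖B‖` — under the DISPLAYED per-level regularity of the backgrounds `V j`.
* (file 2 `ShellMeasureAverageIteratePower`: the one-step identity `M(V′V)(c) = exp(i Q̃_V(B′)(c))·M(V)(c)`, the `k`-fold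
  iterate `avgIter` of the (15)-average, the iterate identity and the (164) SHAPE.)

WHAT THIS DOES NOT DO.  Print's k-UNIFORM domain (needs Prop. 3's sharp linear part, rows S55∕S56); the regularity of the
averaged backgrounds (Props 1–2 TYPE for the (15) average — displayed); the contour-PAIR average (0.4) and the untyped
(0.11); complex (non-unitary) backgrounds (Prop. 7); anything of Bałaban's minimisers or densities; NE7c NOT proved;
0/9 spine.
-/

noncomputable section

open NormedSpace Metric Set

namespace Summit.QuantumFields.BalabanUV.T4Continuum.ShellMeasureAverageIterate

open Literature.MathematicalPhysics.QuantumFieldTheory.Balaban1983to89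
open Literature.MathematicalPhysics.QuantumLattice (ZdEdge)
open B7BlockGeometry (qppBonds)
open B12HOperator267 (gammaT)
open B12AverageCorridor267 (Qtilde Qtilde_congr isBlockLocal_gammaT loopW offAxis)
open ShellMeasureAverageAnalyticB7 (analyticOnNhd_Qtilde_gammaT norm_Qtilde_gammaT_le Qtilde_zero extend_val)

/-! ## §1 Generic: iterating a chain of analytic, vanishing, linearly bounded maps -/

section Generic

variable {E : ℕ → Type*}

/-- The `k`-fold composite `F_{k−1} ∘ ⋯ ∘ F₀ : E 0 → E k` of a level-indexed chain of maps. [folklore] -/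
def iterMap (F : ∀ j, E j → E (j + 1)) : ∀ k, E 0 → E k
  | 0 => id
  | k + 1 => F k ∘ iterMap F k

/-- unfolding at `0`. [folklore] -/
@[simp] theorem iterMap_zero (F : ∀ j, E j → E (j + 1)) (B : E 0) : iterMap F 0 B = B := rfl

/-- unfolding at `k + 1`. [folklore] -/
@[simp] theorem iterMap_succ (F : ∀ j, E j → E (j + 1)) (k : ℕ) (B : E 0) :
    iterMap F (k + 1) B = F k (iterMap F k B) := rfl

variable [∀ j, NormedAddCommGroup (E j)] [∀ j, NormedSpace ℂ (E j)]

/-- **ITERATING ANALYTIC CHART MAPS.**  If every `F j` is analytic on `ball 0 r`, vanishes at `0` and satisfies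
`‖F j B‖ ≤ M‖B‖` there, with `M ≥ 1`, then the `k`-fold composite is analytic on `ball 0 (r ∕ Mᵏ)`, vanishes at `0`, and
satisfies `‖iterMap F k B‖ ≤ Mᵏ‖B‖` there (the image of the small ball stays in `ball 0 r` level by level). [folklore] -/
theorem iterMap_facts (F : ∀ j, E j → E (j + 1)) {r M : ℝ} (hr : 0 < r) (hM : 1 ≤ M)
    (hF : ∀ j, AnalyticOnNhd ℂ (F j) (ball 0 r)) (h0 : ∀ j, F j 0 = 0)
    (hb : ∀ j, ∀ B ∈ ball (0 : E j) r, ‖F j B‖ ≤ M * ‖B‖) (k : ℕ) :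
    AnalyticOnNhd ℂ (iterMap F k) (ball 0 (r / M ^ k)) ∧ iterMap F k 0 = 0 ∧
      ∀ B ∈ ball (0 : E 0) (r / M ^ k), ‖iterMap F k B‖ ≤ M ^ k * ‖B‖ := by
  have hM0 : 0 < M := lt_of_lt_of_le one_pos hM
  induction k with
  | zero =>
    refine ⟨fun B _ => ?_, rfl, fun B _ => by rw [iterMap_zero, pow_zero, one_mul]⟩
    exact analyticAt_id
  | succ k ih =>
    obtain ⟨ihA, ih0, ihb⟩ := ih
    have hpow : 0 < M ^ k := pow_pos hM0 k
    -- the smaller ball sits inside the previous one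
    have hsub : ∀ B ∈ ball (0 : E 0) (r / M ^ (k + 1)), B ∈ ball (0 : E 0) (r / M ^ k) := fun B hB => by
      rw [mem_ball_zero_iff] at hB ⊢
      refine hB.trans_le (div_le_div_of_nonneg_left hr.le hpow ?_)
      rw [pow_succ]
      exact le_mul_of_one_le_right hpow.le hM
    -- and its image under the `k`-fold composite sits inside `ball 0 r`
    have himg : ∀ B ∈ ball (0 : E 0) (r / M ^ (k + 1)), iterMap F k B ∈ ball (0 : E k) r := fun B hB => by
      have hB' := ihb B (hsub B hB)
      rw [mem_ball_zero_iff] at hB ⊢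
      calc ‖iterMap F k B‖ ≤ M ^ k * ‖B‖ := hB'
        _ < M ^ k * (r / M ^ (k + 1)) := mul_lt_mul_of_pos_left hB hpow
        _ = r / M := by rw [pow_succ]; field_simp
        _ ≤ r := div_le_self hr.le hM
    refine ⟨fun B hB => ?_, by rw [iterMap_succ, ih0, h0], fun B hB => ?_⟩
    · exact (hF k _ (himg B hB)).comp (ihA B (hsub B hB))
    · rw [iterMap_succ]
      calc ‖F k (iterMap F k B)‖ ≤ M * ‖iterMap F k B‖ := hb k _ (himg B hB)
        _ ≤ M * (M ^ k * ‖B‖) := mul_le_mul_of_nonneg_left (ihb B (hsub B hB)) hM0.le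
        _ = M ^ (k + 1) * ‖B‖ := by rw [pow_succ]; ring

end Generic

/-! ## §2 The pyramid of finite bond sets and the one-step chart map -/

section Pyramid

variable {d : ℕ} {𝔸 : Type*} [NormedRing 𝔸] [NormedAlgebra ℂ 𝔸] [CompleteSpace 𝔸] [NormOneClass 𝔸] {L : ℕ}

/-- extension by zero of a bond function given on a finite bond set. [folklore] -/
def ext (S : Finset (ZdEdge d)) (B : ↥S → 𝔸) : ZdEdge d → 𝔸 := Function.extend Subtype.val B 0

omit [NormedAlgebra ℂ 𝔸] [CompleteSpace 𝔸] [NormOneClass 𝔸] in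
/-- the extension restricts back to the given values. [folklore] -/
theorem ext_apply_mem {S : Finset (ZdEdge d)} (B : ↥S → 𝔸) {b : ZdEdge d} (hb : b ∈ S) :
    ext S B b = B ⟨b, hb⟩ :=
  Subtype.val_injective.extend_apply _ _ ⟨b, hb⟩

omit [NormedAlgebra ℂ 𝔸] [CompleteSpace 𝔸] [NormOneClass 𝔸] in
/-- `ext S 0 = 0`. [folklore] -/
theorem ext_zero (S : Finset (ZdEdge d)) : ext S (0 : ↥S → 𝔸) = 0 := by
  funext b
  by_cases hb : b ∈ S
  · rw [ext_apply_mem _ hb]; rfl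
  · unfold ext
    rw [Function.extend_apply' _ _ _ fun ⟨a, ha⟩ => hb (ha ▸ a.2), Pi.zero_apply]

/-- THE RESTRICTION to a smaller finite bond set, as a continuous linear map. [folklore] -/
def restr {S S' : Finset (ZdEdge d)} (h : S' ⊆ S) : (↥S → 𝔸) →L[ℂ] (↥S' → 𝔸) :=
  ContinuousLinearMap.pi fun i : ↥S' => ContinuousLinearMap.proj (R := ℂ) (φ := fun _ : ↥S => 𝔸) ⟨i.1, h i.2⟩

omit [CompleteSpace 𝔸] [NormOneClass 𝔸] in
/-- unfolding. [folklore] -/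
@[simp] theorem restr_apply {S S' : Finset (ZdEdge d)} (h : S' ⊆ S) (B : ↥S → 𝔸) (i : ↥S') :
    restr h B i = B ⟨i.1, h i.2⟩ := rfl

omit [CompleteSpace 𝔸] [NormOneClass 𝔸] in
/-- restriction does not increase the sup norm. [folklore] -/
theorem norm_restr_le {S S' : Finset (ZdEdge d)} (h : S' ⊆ S) (B : ↥S → 𝔸) : ‖restr h B‖ ≤ ‖B‖ :=
  (pi_norm_le_iff_of_nonneg (norm_nonneg B)).2 fun i => by rw [restr_apply]; exact norm_le_pi_norm B _

omit [NormOneClass 𝔸] in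
/-- BLOCK LOCALITY OF THE CHART AVERAGE on the pyramid: for `qppBonds L c ⊆ S`, the chart average of `ext_S B` at `c`
is S49 f2's chart average of the restriction of `B` to `B(c₋) ∪ B(c₊)` (`B12AverageCorridor267.Qtilde_congr` +
`isBlockLocal_gammaT`). [folklore] -/
theorem Qtilde_ext_eq_of_subset (hL : 0 < L) {S : Finset (ZdEdge d)} {c : ZdEdge d} (h : qppBonds L c ⊆ S)
    (V : ZdEdge d → 𝔸ˣ) (B : ↥S → 𝔸) :
    Qtilde L (fun U : ZdEdge d → 𝔸ˣ => gammaT L U) V (ext S B) c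
      = Qtilde L (fun U : ZdEdge d → 𝔸ˣ => gammaT L U) V
          (Function.extend Subtype.val (restr h B) (0 : ZdEdge d → 𝔸)) c :=
  Qtilde_congr hL (isBlockLocal_gammaT hL) V fun b hb => by
    rw [ext_apply_mem B (h hb), extend_val (restr h B) ⟨b, hb⟩, restr_apply]

variable (L) in
/-- THE ONE-STEP CHART MAP ON THE PYRAMID: level-`j` bond functions on `T j` ↦ the chart averages `Q̃_{V j}(ext B)(c)`,
`c ∈ T (j+1)`. [folklore] -/
def chartStep (T : ℕ → Finset (ZdEdge d)) (V : ℕ → ZdEdge d → 𝔸ˣ) (j : ℕ) (B : ↥(T j) → 𝔸) : ↥(T (j + 1)) → 𝔸 :=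
  fun c => Qtilde L (fun U : ZdEdge d → 𝔸ˣ => gammaT L U) (V j) (ext (T j) B) c

variable {T : ℕ → Finset (ZdEdge d)} {V : ℕ → ZdEdge d → 𝔸ˣ}

omit [NormOneClass 𝔸] in
/-- the chart map vanishes at `0`. [folklore] -/
theorem chartStep_zero (j : ℕ) : chartStep L T V j 0 = 0 := by
  funext c
  show Qtilde L (fun U : ZdEdge d → 𝔸ˣ => gammaT L U) (V j) (ext (T j) 0) c = 0
  rw [ext_zero, Qtilde_zero]

variable (hL : 0 < L) (hT : ∀ j, ∀ c ∈ T (j + 1), qppBonds L c ⊆ T j)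
  (hV : ∀ j b, ‖((V j b : 𝔸ˣ) : 𝔸)‖ ≤ 1) (hV' : ∀ j b, ‖(((V j b)⁻¹ : 𝔸ˣ) : 𝔸)‖ ≤ 1)
  {ε : ℝ} (hε0 : 0 ≤ ε) (hε : ε ≤ 1 / 8)
  (hW : ∀ j, ∀ c ∈ T (j + 1), ∀ x ∈ offAxis L c,
    ‖((loopW L (fun U : ZdEdge d → 𝔸ˣ => gammaT L U) (V j) c x : 𝔸ˣ) : 𝔸) - 1‖ ≤ ε)
include hL hT hV hV' hε0 hε hW

/-- the chart map is analytic on `ball 0 (1∕(2816(d+1)L))` (coordinatewise S49 f2's `analyticOnNhd_Qtilde_gammaT`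
composed with the restriction CLM). [folklore] -/
theorem chartStep_analyticOnNhd (j : ℕ) :
    AnalyticOnNhd ℂ (chartStep L T V j) (ball 0 (1 / (2816 * ((d : ℝ) + 1) * L))) := by
  refine AnalyticOnNhd.pi fun c => fun B hB => ?_
  have key : (fun B : ↥(T j) → 𝔸 => chartStep L T V j B c) =
      (fun B' : ↥(qppBonds L (c : ZdEdge d)) → 𝔸 => Qtilde L (fun U : ZdEdge d → 𝔸ˣ => gammaT L U) (V j)
        (Function.extend Subtype.val B' (0 : ZdEdge d → 𝔸)) c) ∘ restr (hT j c c.2) := by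
    funext B
    exact Qtilde_ext_eq_of_subset hL (hT j c c.2) (V j) B
  rw [key]
  have hB' : restr (hT j c c.2) B ∈ ball (0 : ↥(qppBonds L (c : ZdEdge d)) → 𝔸) (1 / (2816 * ((d : ℝ) + 1) * L)) := by
    rw [mem_ball_zero_iff] at hB ⊢
    exact (norm_restr_le _ B).trans_lt hB
  exact (analyticOnNhd_Qtilde_gammaT hL (hV j) (hV' j) hε0 hε (hW j c c.2) _ hB').comp
    ((restr (hT j c c.2)).analyticAt B)

/-- the chart map is linearly bounded there: `‖chartStep j B‖ ≤ 2816(d+1)L·‖B‖` (coordinatewise S49 f2's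
`norm_Qtilde_gammaT_le` + `‖restr B‖ ≤ ‖B‖`). [folklore] -/
theorem norm_chartStep_le (j : ℕ) {B : ↥(T j) → 𝔸} (hB : B ∈ ball (0 : ↥(T j) → 𝔸) (1 / (2816 * ((d : ℝ) + 1) * L))) :
    ‖chartStep L T V j B‖ ≤ 2816 * ((d : ℝ) + 1) * L * ‖B‖ := by
  have hM : (0 : ℝ) ≤ 2816 * ((d : ℝ) + 1) * L := by positivity
  refine (pi_norm_le_iff_of_nonneg (mul_nonneg hM (norm_nonneg B))).2 fun c => ?_
  show ‖Qtilde L (fun U : ZdEdge d → 𝔸ˣ => gammaT L U) (V j) (ext (T j) B) c‖ ≤ _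
  rw [Qtilde_ext_eq_of_subset hL (hT j c c.2) (V j) B]
  have hB' : ‖restr (hT j c c.2) B‖ < 1 / (2816 * ((d : ℝ) + 1) * L) :=
    (norm_restr_le _ B).trans_lt (mem_ball_zero_iff.1 hB)
  exact (norm_Qtilde_gammaT_le hL (hV j) (hV' j) hε0 hε (hW j c c.2) hB').trans
    (mul_le_mul_of_nonneg_left (norm_restr_le _ B) hM)

end Pyramid

/-! ## §3 The `k`-fold chart iterate: analytic, vanishing, linearly bounded -/

section Iterate

variable {d : ℕ} {𝔸 : Type*} [NormedRing 𝔸] [NormedAlgebra ℂ 𝔸] [CompleteSpace 𝔸] [NormOneClass 𝔸] {L : ℕ}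

variable (L) in
/-- THE `k`-FOLD CHART ITERATE on the pyramid: `chartStep (k−1) ∘ ⋯ ∘ chartStep 0`. [folklore] -/
def chartIter (T : ℕ → Finset (ZdEdge d)) (V : ℕ → ZdEdge d → 𝔸ˣ) : ∀ k, (↥(T 0) → 𝔸) → (↥(T k) → 𝔸) :=
  iterMap (E := fun j => ↥(T j) → 𝔸) (chartStep L T V)

variable {T : ℕ → Finset (ZdEdge d)} {V : ℕ → ZdEdge d → 𝔸ˣ}

omit [NormOneClass 𝔸] in
/-- unfolding at `0`. [folklore] -/
@[simp] theorem chartIter_zero_apply (B : ↥(T 0) → 𝔸) : chartIter L T V 0 B = B := rfl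

omit [NormOneClass 𝔸] in
/-- unfolding at `k + 1`. [folklore] -/
theorem chartIter_succ_apply (k : ℕ) (B : ↥(T 0) → 𝔸) :
    chartIter L T V (k + 1) B = chartStep L T V k (chartIter L T V k B) := rfl

variable (hL : 0 < L) (hT : ∀ j, ∀ c ∈ T (j + 1), qppBonds L c ⊆ T j)
  (hV : ∀ j b, ‖((V j b : 𝔸ˣ) : 𝔸)‖ ≤ 1) (hV' : ∀ j b, ‖(((V j b)⁻¹ : 𝔸ˣ) : 𝔸)‖ ≤ 1)
  {ε : ℝ} (hε0 : 0 ≤ ε) (hε : ε ≤ 1 / 8)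
  (hW : ∀ j, ∀ c ∈ T (j + 1), ∀ x ∈ offAxis L c,
    ‖((loopW L (fun U : ZdEdge d → 𝔸ˣ => gammaT L U) (V j) c x : 𝔸ˣ) : 𝔸) - 1‖ ≤ ε)
include hL hT hV hV' hε0 hε hW

/-- the three facts at once (§1 applied with `r = 1∕M`, `M = 2816(d+1)L`). [folklore] -/
theorem chartIter_facts (k : ℕ) :
    AnalyticOnNhd ℂ (chartIter L T V k)
        (ball 0 (1 / (2816 * ((d : ℝ) + 1) * L) / (2816 * ((d : ℝ) + 1) * L) ^ k)) ∧
      chartIter L T V k 0 = 0 ∧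
      ∀ B ∈ ball (0 : ↥(T 0) → 𝔸) (1 / (2816 * ((d : ℝ) + 1) * L) / (2816 * ((d : ℝ) + 1) * L) ^ k),
        ‖chartIter L T V k B‖ ≤ (2816 * ((d : ℝ) + 1) * L) ^ k * ‖B‖ := by
  have hLr : (1 : ℝ) ≤ L := by exact_mod_cast hL
  have hM : (1 : ℝ) ≤ 2816 * ((d : ℝ) + 1) * L := by nlinarith [(Nat.cast_nonneg d : (0 : ℝ) ≤ d)]
  exact iterMap_facts (E := fun j => ↥(T j) → 𝔸) (chartStep L T V) (by positivity) hM
    (fun j => chartStep_analyticOnNhd hL hT hV hV' hε0 hε hW j) (fun j => chartStep_zero j)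
    (fun j B hB => norm_chartStep_le hL hT hV hV' hε0 hε hW j hB) k

/-- **THE `k`-FOLD CHART ITERATE IS ANALYTIC** on `ball 0 (M⁻¹·M⁻ᵏ)`, `M = 2816(d+1)L` — radius shrinking
geometrically in `k` (honest difference (i) of the header). [folklore] -/
theorem chartIter_analyticOnNhd (k : ℕ) :
    AnalyticOnNhd ℂ (chartIter L T V k)
      (ball 0 (1 / (2816 * ((d : ℝ) + 1) * L) / (2816 * ((d : ℝ) + 1) * L) ^ k)) :=
  (chartIter_facts hL hT hV hV' hε0 hε hW k).1

omit hL hT hV hV' hε0 hε hW in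
omit [NormOneClass 𝔸] in
/-- **… VANISHES AT `0`** (no hypothesis). [folklore] -/
theorem chartIter_zero (k : ℕ) : chartIter L T V k 0 = 0 := by
  induction k with
  | zero => rfl
  | succ k ih => rw [chartIter_succ_apply, ih, chartStep_zero]

/-- **… AND IS LINEARLY BOUNDED**: `‖chartIter k B‖ ≤ Mᵏ‖B‖` on that ball. [folklore] -/
theorem norm_chartIter_le (k : ℕ) {B : ↥(T 0) → 𝔸}
    (hB : B ∈ ball (0 : ↥(T 0) → 𝔸) (1 / (2816 * ((d : ℝ) + 1) * L) / (2816 * ((d : ℝ) + 1) * L) ^ k)) :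
    ‖chartIter L T V k B‖ ≤ (2816 * ((d : ℝ) + 1) * L) ^ k * ‖B‖ :=
  (chartIter_facts hL hT hV hV' hε0 hε hW k).2.2 B hB

end Iterate

end Summit.QuantumFields.BalabanUV.T4Continuum.ShellMeasureAverageIterate

end
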